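import Summits.RiemannHypothesis.RiemannHypothesis.Theorems.PfPersistenceEdgeLawCornerEnergy
import HarnessLib

/-!
# The corner formula for the Pohozaev defect (pub-rhpf theory-2, gen 4, Part G2)

Mechanism/rigidity campaign; no RH claims. RH-free helper lemmas (item
stmt-RiemannHypothesis-19953, `--as helper`).

From the bounds of `PfPersistenceEdgeLawCornerEnergy` (`0 ≤ D_s(σ_h) − 𝒥(s,h) ≤ min(4K²|s|, 2m_h)`):
* **key estimate** `L_a(u,h) − 𝒞_a(u,h) ≤ 4K²θh + 2m_h/θ` (`0 < θ ≤ 1`, `0 < h ≤ 1`);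
* **the cut spill is negligible**: `(L_a(u,h) − 𝒞_a(u,h))/h → 0` for a ground state with an edge
  intensity (`tendsto_edgeLayerLocalEnergy_sub_cornerEnergy_div`), so hypothesis (R2) of
  `LayerRegularAt` is equivalent to `𝒞_a(u,h) = o(h)` (`tendsto_cornerEnergy_div_iff`);
* **corner formula**: under interior regularity (R3), `𝒞_a(u,h)/h → V/a − I`
  (`tendsto_cornerEnergy_div_of_interiorRegular`) — the Pohozaev defect `V − a·I` of a ground
  state is `a` times the rate of the mass that the energy measure `ρ(s)‖ũ(x+s) − ũ(x)‖² dx ds`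
  gives to the corner `{0 < s ≤ h, both feet within h of the edge}`;
* `tendsto_cornerEnergy_div_iff_virial_eq`: under (R3), `𝒞_a(u,h) = o(h)` ⟺ `V = 2c₀·a·I`
  ((R2′) is the exact residue); `weilLogPohozaevAt_iff_corner_of_interiorRegular` (window
  level) and `weilLogPohozaevAt_of_corner`: R6 from corner regularity + (R3).

Reference: E. Bombieri, *Remarks on Weil's quadratic functional in the theory of prime numbers,
I*, Rend. Mat. Acc. Lincei (9) 11 (2000) 183–233, §4 Thm 3, §6.
-/

set_option linter.dupNamespace false

noncomputable section

open MeasureTheory Set Filter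
open scoped Topology

namespace Summit.RiemannHypothesis.RiemannHypothesis.Theorems.PfPersistence

open Literature.NumberTheory.LFunctions
open Summit.RiemannHypothesis.RiemannHypothesis.Theorems.WeilWindowFlowWindowLipschitz
  (stub_commutatorBound_measurableSet_layer stub_commutatorBound_rho_le_inv)

variable {a : ℝ} {u : ℝ → ℂ}

/-- **Key estimate.** For `0 < θ ≤ 1`, `0 < h ≤ 1` and a sup bound `‖u‖ ≤ K` a.e.:
`L_a(u,h) − 𝒞_a(u,h) ≤ 4K²θh + 2m_h/θ` (split `(0,h] = (0,θh] ∪ (θh,h]`; on the first piece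
`ρ·4K²s ≤ 4K²` by `sρ(s) ≤ 1`, on the second `ρ·2m_h ≤ 2m_h/(θh)`). [folklore] -/
theorem edgeLayerLocalEnergy_sub_cornerEnergy_le (hu : IsWeilGroundState a u) {K : ℝ}
    (hK : ∀ᵐ x : ℝ, ‖u x‖ ≤ K) {θ h : ℝ} (hθ : 0 < θ) (hθ1 : θ ≤ 1) (hh : 0 < h) (hh1 : h ≤ 1) :
    edgeLayerLocalEnergy a u h - cornerEnergy a u h ≤
      4 * K ^ 2 * θ * h + 2 * edgeMass (weilTrunc a u) a h / θ := by
  set m := edgeMass (weilTrunc a u) a h with hm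
  have hm0 : 0 ≤ m := setIntegral_nonneg (stub_commutatorBound_measurableSet_layer a h)
    fun _ _ ↦ by positivity
  set F : ℝ → ℝ := fun s ↦ weilArchDensity s * weilIncrement (weilEdgeLayer a u h) s -
    weilArchDensity s * cornerIncrement a u h s with hF
  have hL := (integrableOn_arch_weilEdgeLayer hu h).mono_set
    (Ioc_subset_Ioi_self : Ioc (0 : ℝ) h ⊆ Ioi 0)
  have hC := integrableOn_arch_cornerIncrement hu h
  have hFi : IntegrableOn F (Ioc 0 h) := hL.sub hC
  have hdiff : edgeLayerLocalEnergy a u h - cornerEnergy a u h = ∫ s in Ioc 0 h, F s := by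
    rw [edgeLayerLocalEnergy, cornerEnergy, ← integral_sub hL hC]
  -- pointwise bounds on `F`
  have hF1 : ∀ s ∈ Ioc 0 h, F s ≤ 4 * K ^ 2 := fun s hs ↦ by
    have hρ := (weilArchDensity_pos hs.1).le
    have hρs : weilArchDensity s ≤ 1 / s :=
      stub_commutatorBound_rho_le_inv hs.1 (hs.2.trans hh1)
    have hb := weilIncrement_sub_corner_le_mul_abs hu hK h s
    have hs0 : s ≠ 0 := hs.1.ne'
    rw [abs_of_pos hs.1] at hb
    calc F s = weilArchDensity s * (weilIncrement (weilEdgeLayer a u h) s -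
          cornerIncrement a u h s) := by rw [hF]; ring
      _ ≤ 1 / s * (4 * K ^ 2 * s) :=
          mul_le_mul hρs hb (by linarith [cornerIncrement_le_weilIncrement hu h s])
            (one_div_nonneg.2 hs.1.le)
      _ = 4 * K ^ 2 := by field_simp
  have hF2 : ∀ s ∈ Ioc (θ * h) h, F s ≤ 2 * m / (θ * h) := fun s hs ↦ by
    have hθh : 0 < θ * h := mul_pos hθ hh
    have hs0 : 0 < s := hθh.trans hs.1
    have hρ := (weilArchDensity_pos hs0).le
    have hρs : weilArchDensity s ≤ 1 / (θ * h) :=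
      (stub_commutatorBound_rho_le_inv hs0 (hs.2.trans hh1)).trans
        (one_div_le_one_div_of_le hθh hs.1.le)
    have hb := weilIncrement_sub_corner_le_edgeMass hu h s
    calc F s = weilArchDensity s * (weilIncrement (weilEdgeLayer a u h) s -
          cornerIncrement a u h s) := by rw [hF]; ring
      _ ≤ 1 / (θ * h) * (2 * m) :=
          mul_le_mul hρs hb (by linarith [cornerIncrement_le_weilIncrement hu h s])
            (one_div_nonneg.2 hθh.le)
      _ = 2 * m / (θ * h) := by ring
  -- split the domain
  have hθh : θ * h ≤ h := by nlinarith
  have hsplit : ∫ s in Ioc 0 h, F s = (∫ s in Ioc 0 (θ * h), F s) + ∫ s in Ioc (θ * h) h, F s := by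
    rw [← setIntegral_union (Ioc_disjoint_Ioc_of_le le_rfl) measurableSet_Ioc
      (hFi.mono_set (Ioc_subset_Ioc_right hθh))
      (hFi.mono_set (Ioc_subset_Ioc_left (mul_pos hθ hh).le)),
      Ioc_union_Ioc_eq_Ioc (mul_pos hθ hh).le hθh]
  have hI1 : ∫ s in Ioc 0 (θ * h), F s ≤ 4 * K ^ 2 * θ * h := by
    have := setIntegral_mono_on (hFi.mono_set (Ioc_subset_Ioc_right hθh))
      (integrableOn_const (hs := measure_Ioc_lt_top.ne)) measurableSet_Ioc
      (fun s hs ↦ hF1 s ⟨hs.1, hs.2.trans hθh⟩)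
    rw [setIntegral_const, Real.volume_real_Ioc_of_le (mul_pos hθ hh).le, sub_zero,
      smul_eq_mul] at this
    linarith
  have hI2 : ∫ s in Ioc (θ * h) h, F s ≤ 2 * m / θ := by
    have := setIntegral_mono_on (hFi.mono_set (Ioc_subset_Ioc_left (mul_pos hθ hh).le))
      (integrableOn_const (hs := measure_Ioc_lt_top.ne)) measurableSet_Ioc (fun s hs ↦ hF2 s hs)
    rw [setIntegral_const, Real.volume_real_Ioc_of_le hθh, smul_eq_mul] at this
    refine this.trans ?_
    have hθ0 : θ ≠ 0 := hθ.ne'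
    have hh0 : h ≠ 0 := hh.ne'
    have h1 : (h - θ * h) * (2 * m / (θ * h)) = 2 * m / θ * (1 - θ) := by
      field_simp
    rw [h1]
    have h2 : 0 ≤ 2 * m / θ := by positivity
    nlinarith
  rw [hdiff, hsplit]
  linarith

/-- **The cut spill is negligible**: for a ground state with an edge intensity,
`(L_a(u,h) − 𝒞_a(u,h))/h → 0` as `h → 0⁺`. [cite: Bombieri2000Weil, §4 Thm 3] -/
theorem tendsto_edgeLayerLocalEnergy_sub_cornerEnergy_div (hu : IsWeilGroundState a u) {I : ℝ}
    (hI : HasEdgeIntensity u a I) :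
    Tendsto (fun h ↦ (edgeLayerLocalEnergy a u h - cornerEnergy a u h) / h) (𝓝[>] 0)
      (𝓝 0) := by
  obtain ⟨K, hK0, hK⟩ := exists_ae_norm_le hu
  have hm := tendsto_edgeMass_div (hasEdgeIntensity_weilTrunc hu hI)
  refine tendsto_order.2 ⟨fun b hb ↦ ?_, fun b hb ↦ ?_⟩
  · filter_upwards [self_mem_nhdsWithin] with h (hh : 0 < h)
    exact hb.trans_le (div_nonneg
      (sub_nonneg.2 (cornerEnergy_le_edgeLayerLocalEnergy hu h)) hh.le)
  · -- choose `θ` with `4K²θ ≤ b/2`, then `h` small with `2(m_h/h)/θ < b/2`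
    set θ : ℝ := min 1 (b / (8 * K ^ 2 + 8)) with hθdef
    have hθ : 0 < θ := lt_min one_pos (div_pos hb (by positivity))
    have hθ1 : θ ≤ 1 := min_le_left _ _
    have hθb : 4 * K ^ 2 * θ ≤ b / 2 := by
      have h1 : θ ≤ b / (8 * K ^ 2 + 8) := min_le_right _ _
      have h2 : 4 * K ^ 2 * θ ≤ 4 * K ^ 2 * (b / (8 * K ^ 2 + 8)) :=
        mul_le_mul_of_nonneg_left h1 (by positivity)
      refine h2.trans ?_
      rw [mul_div_assoc', div_le_div_iff₀ (by positivity) two_pos]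
      nlinarith [sq_nonneg K]
    have hev := hm.eventually (Iio_mem_nhds (show (0 : ℝ) < b * θ / 4 by positivity))
    filter_upwards [hev, Ioc_mem_nhdsGT one_pos] with h hmh hh
    have hkey := edgeLayerLocalEnergy_sub_cornerEnergy_le hu hK hθ hθ1 hh.1 hh.2
    have hmh' : edgeMass (weilTrunc a u) a h / h < b * θ / 4 := hmh
    rw [div_lt_iff₀ hh.1]
    have h3 : 2 * edgeMass (weilTrunc a u) a h / θ < b / 2 * h := by
      rw [div_lt_iff₀ hθ]
      have := (div_lt_iff₀ hh.1).1 hmh'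
      nlinarith
    have h4 : 4 * K ^ 2 * θ * h ≤ b / 2 * h := mul_le_mul_of_nonneg_right hθb hh.1.le
    linarith

/-- **(R2) ⟺ (R2′)**: for a ground state with an edge intensity, `L_a(u,h) = o(h)` iff
`𝒞_a(u,h) = o(h)`. [folklore] -/
theorem tendsto_cornerEnergy_div_iff (hu : IsWeilGroundState a u) {I : ℝ}
    (hI : HasEdgeIntensity u a I) :
    Tendsto (fun h ↦ cornerEnergy a u h / h) (𝓝[>] 0) (𝓝 0) ↔
      Tendsto (fun h ↦ edgeLayerLocalEnergy a u h / h) (𝓝[>] 0) (𝓝 0) := by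
  have hd := tendsto_edgeLayerLocalEnergy_sub_cornerEnergy_div hu hI
  constructor <;> intro ht
  · have := hd.add ht
    rw [zero_add] at this
    exact this.congr fun h ↦ by ring
  · have := ht.sub hd
    rw [sub_zero] at this
    exact this.congr fun h ↦ by ring

/-- **The corner formula.** Under interior regularity (R3), for a ground state with virial `V`
and edge intensity `I`: `𝒞_a(u,h)/h → V/a − I` — the Pohozaev defect is `a` times the corner
mass rate of the energy measure. [cite: Bombieri2000Weil, §4 Thm 3, §6] -/
theorem tendsto_cornerEnergy_div_of_interiorRegular (hu : IsWeilGroundState a u) {V I : ℝ}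
    (hV : HasDerivAt (weilDilationProfile a u) V 0) (hI : HasEdgeIntensity u a I)
    (htail : Tendsto (fun η ↦ windowDefectForm a (weilInteriorDefect a u η) / η)
      (𝓝[>] 0) (𝓝 0)) :
    Tendsto (fun h ↦ cornerEnergy a u h / h) (𝓝[>] 0) (𝓝 (V / a - I)) := by
  have h1 := tendsto_edgeLayerLocalEnergy_div_of_interiorRegular hu hV hI htail
  have h2 := tendsto_edgeLayerLocalEnergy_sub_cornerEnergy_div hu hI
  have := h1.sub h2
  rw [sub_zero] at this
  exact this.congr fun h ↦ by ring

/-- **Corner regularity ⟺ log-Pohozaev, under (R3).** For a ground state with virial `V`, edge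
intensity `I` and an `o(η)` interior dilation defect: `𝒞_a(u,h) = o(h)` iff
`V = 2c₀·a·I` — hypothesis (R2′) is the EXACT residue of the identity. [folklore] -/
theorem tendsto_cornerEnergy_div_iff_virial_eq (hu : IsWeilGroundState a u) {V I : ℝ}
    (hV : HasDerivAt (weilDilationProfile a u) V 0) (hI : HasEdgeIntensity u a I)
    (htail : Tendsto (fun η ↦ windowDefectForm a (weilInteriorDefect a u η) / η)
      (𝓝[>] 0) (𝓝 0)) :
    Tendsto (fun h ↦ cornerEnergy a u h / h) (𝓝[>] 0) (𝓝 0) ↔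
      V = 2 * edgeLawKernelConstant * a * I := by
  refine ⟨fun h ↦ virial_eq_of_layerRegular hu hV hI
    (eventually_integrableOn_arch_weilEdgeLayer hu) ((tendsto_cornerEnergy_div_iff hu hI).1 h)
    htail, fun h ↦ ?_⟩
  have hlim := tendsto_cornerEnergy_div_of_interiorRegular hu hV hI htail
  have ha : a ≠ 0 := hu.pos.ne'
  have h0 : V / a - I = 0 := by
    rw [h, edgeLawKernelConstant, show (2 : ℝ) * (1 / 2) = 1 by norm_num, one_mul,
      mul_div_cancel_left₀ I ha, sub_self]
  rwa [h0] at hlim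

/-- **Window level.** If every ground state of the window `a` has an `o(η)` interior dilation
defect (R3), then `WeilLogPohozaevAt a` holds iff every ground state with a virial and an edge
intensity has an `o(h)` corner energy (R2′). [folklore] -/
theorem weilLogPohozaevAt_iff_corner_of_interiorRegular
    (hR3 : ∀ u : ℝ → ℂ, IsWeilGroundState a u →
      Tendsto (fun η ↦ windowDefectForm a (weilInteriorDefect a u η) / η) (𝓝[>] 0) (𝓝 0)) :
    WeilLogPohozaevAt a ↔ ∀ (u : ℝ → ℂ) (V I : ℝ), IsWeilGroundState a u →
      HasDerivAt (weilDilationProfile a u) V 0 → HasEdgeIntensity u a I →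
        Tendsto (fun h ↦ cornerEnergy a u h / h) (𝓝[>] 0) (𝓝 0) :=
  ⟨fun h u V I hu hV hI ↦ (tendsto_cornerEnergy_div_iff_virial_eq hu hV hI (hR3 u hu)).2
      (h u V I hu hV hI),
    fun h u V I hu hV hI ↦ (tendsto_cornerEnergy_div_iff_virial_eq hu hV hI (hR3 u hu)).1
      (h u V I hu hV hI)⟩

/-- **R6 from corner regularity**: if every ground state of the window has an `o(h)` corner
energy and an `o(η)` interior dilation defect, then `WeilLogPohozaevAt a`. [folklore] -/
theorem weilLogPohozaevAt_of_corner
    (h : ∀ u : ℝ → ℂ, IsWeilGroundState a u →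
      (∀ I : ℝ, HasEdgeIntensity u a I →
        Tendsto (fun h ↦ cornerEnergy a u h / h) (𝓝[>] 0) (𝓝 0)) ∧
      Tendsto (fun η ↦ windowDefectForm a (weilInteriorDefect a u η) / η) (𝓝[>] 0) (𝓝 0)) :
    WeilLogPohozaevAt a := fun u _ _ hu hV hI ↦
  virial_eq_of_layerRegular hu hV hI (eventually_integrableOn_arch_weilEdgeLayer hu)
    ((tendsto_cornerEnergy_div_iff hu hI).1 ((h u hu).1 _ hI)) (h u hu).2

end Summit.RiemannHypothesis.RiemannHypothesis.Theorems.PfPersistence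

end
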